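import Summits.AtomisticToContinuum.HydrodynamicLimit.Theorems.RelayRaceLocalityConeLocalisationElevatorDefs
import Summits.AtomisticToContinuum.HydrodynamicLimit.Theorems.ImplosionDichotomyHsEosLowDensity
import Summits.AtomisticToContinuum.HydrodynamicLimit.Theorems.PolynomialCompression.Negative.SmoothPressure
import Summits.AtomisticToContinuum.HydrodynamicLimit.Theorems.ImplosionDichotomyPolynomialCompressionFrozenCommutator
import Literature.Analysis.FluidPDE.MVRelativeEnergyPointwiseBounds
import HarnessLib

/-!
# RelayRaceLocality · ConeLocalisation — line `einstein-elevator`, stub `stub_logSlope` (part A)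

Support file for the crux item `stmt-AtomisticToContinuum-12504` (`ConeLocalisation`, route RelayRaceLocality of
`AtomisticToContinuum/HydrodynamicLimit`), first of three files proving the registered stub
`stub_logSlope : DynamicLogSlopeBound` of the line `einstein-elevator` (Props in
`Theorems/RelayRaceLocalityConeLocalisationElevatorDefs.lean`): the floor-free a-priori estimate
`|∂ᵢ log ρ| ≤ C Mᵃ / t` for one classical hard-sphere Euler solution whose level-`M` guards survive on
`[0, t] × 𝕋³`, by the Lagrangian both-ends argument (`D_t uⱼ = -Gⱼ`, `|D_t G| ≤ A ‖G‖ + B`,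
`‖u‖ ≤ M` at both ends of every path).

This part (namespace `…Elevator.LogSlope`): (1) the both-ends ODE lemma `norm_le_of_both_ends`;
(2) the smooth equation of state on a packing band (`eos_band`, from `hsEosLowDensity_proof`);
(3) the elementary inequalities of the `D_t G` bookkeeping; (4) the scalar guard bounds at a guarded
point (`guard_bounds`).
-/

noncomputable section

namespace Summit.AtomisticToContinuum.HydrodynamicLimit.Theorems.ConeLocalisation.Elevator.LogSlope

open scoped Topology ContDiff NNReal
open Filter Set MeasureTheory
open Literature.MathematicalPhysics.KineticTheory Literature.Analysis.FluidPDE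
  Literature.Analysis.FunctionSpaces
open Literature.Analysis.FluidPDE.CompressibleEuler (abs_mul_le_of_le)

/-! ### Step 1: the both-ends ODE lemma -/

/-- **Both-ends ODE lemma.** If `φ' = -g` and `‖g'‖ ≤ A ‖g‖ + B` on `[s₁, s₂]` with
`A (s₂ - s₁) ≤ 1/4`, then `‖g‖ ≤ (3/2) ‖φ s₂ - φ s₁‖ / (s₂ - s₁) + 2 B (s₂ - s₁)` on `[s₁, s₂]`
(mean value inequality twice). [folklore] -/
theorem norm_le_of_both_ends {E : Type*} [NormedAddCommGroup E] [NormedSpace ℝ E]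
    {φ g : ℝ → E} {s₁ s₂ A B D : ℝ} (hlt : s₁ < s₂)
    (hφ : ∀ s ∈ Icc s₁ s₂, HasDerivWithinAt φ (-g s) (Icc s₁ s₂) s)
    (hg : ∀ s ∈ Icc s₁ s₂, ∃ v, HasDerivWithinAt g v (Icc s₁ s₂) s ∧ ‖v‖ ≤ A * ‖g s‖ + B)
    (hA : 0 ≤ A) (hB : 0 ≤ B) (hAℓ : A * (s₂ - s₁) ≤ 1 / 4) (hD : ‖φ s₂ - φ s₁‖ ≤ D)
    {s : ℝ} (hs : s ∈ Icc s₁ s₂) :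
    ‖g s‖ ≤ 3 / 2 * D / (s₂ - s₁) + 2 * B * (s₂ - s₁) := by
  choose! g' hg' hg'n using hg
  set ℓ := s₂ - s₁ with hℓ
  have hℓ0 : 0 < ℓ := sub_pos.2 hlt
  have hcont : ContinuousOn (fun τ => ‖g τ‖) (Icc s₁ s₂) :=
    ContinuousOn.norm fun τ hτ => (hg' τ hτ).continuousWithinAt
  obtain ⟨s₀, hs₀, hmax⟩ := (isCompact_Icc (a := s₁) (b := s₂)).exists_isMaxOn
    (nonempty_Icc.2 hlt.le) hcont
  set m := ‖g s₀‖ with hm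
  have hgm : ∀ τ ∈ Icc s₁ s₂, ‖g τ‖ ≤ m := fun τ hτ => hmax hτ
  have hm0 : 0 ≤ m := norm_nonneg _
  have hg'b : ∀ τ ∈ Icc s₁ s₂, ‖g' τ‖ ≤ A * m + B := fun τ hτ =>
    (hg'n τ hτ).trans (by nlinarith [hgm τ hτ])
  -- mean value inequality for `g`
  have hmv : ∀ τ ∈ Icc s₁ s₂, ‖g τ - g s‖ ≤ (A * m + B) * ℓ := by
    intro τ hτ
    have h := (convex_Icc s₁ s₂).norm_image_sub_le_of_norm_hasDerivWithin_le hg' hg'b hs hτ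
    refine h.trans (mul_le_mul_of_nonneg_left ?_ (by positivity))
    rw [Real.norm_eq_abs, abs_le]
    constructor <;> linarith [hτ.1, hτ.2, hs.1, hs.2]
  have h1 : m ≤ ‖g s‖ + (A * m + B) * ℓ := by
    have h := hmv s₀ hs₀
    have h' : ‖g s₀‖ ≤ ‖g s‖ + ‖g s₀ - g s‖ := norm_le_insert' _ _
    linarith
  -- mean value inequality for `ψ = φ + (· - s) • g s`
  have hψ : ∀ τ ∈ Icc s₁ s₂,
      HasDerivWithinAt (fun τ => φ τ + (τ - s) • g s) (-g τ + g s) (Icc s₁ s₂) τ := by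
    intro τ hτ
    have h := ((hasDerivWithinAt_id τ (Icc s₁ s₂)).sub_const s).smul_const (g s)
    rw [one_smul] at h
    exact (hφ τ hτ).add h
  have hψ' : ∀ τ ∈ Icc s₁ s₂, ‖-g τ + g s‖ ≤ (A * m + B) * ℓ := by
    intro τ hτ
    rw [← norm_neg, neg_add, neg_neg, ← sub_eq_add_neg]
    exact hmv τ hτ
  have h2 := (convex_Icc s₁ s₂).norm_image_sub_le_of_norm_hasDerivWithin_le hψ hψ'
    (left_mem_Icc.2 hlt.le) (right_mem_Icc.2 hlt.le)
  have hkey : ℓ * ‖g s‖ ≤ D + (A * m + B) * ℓ * ℓ := by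
    have e : (φ s₂ + (s₂ - s) • g s) - (φ s₁ + (s₁ - s) • g s) = (φ s₂ - φ s₁) + ℓ • g s := by
      rw [hℓ, sub_smul, sub_smul, sub_smul]
      abel
    have hn : ‖s₂ - s₁‖ = ℓ := by rw [Real.norm_eq_abs, abs_of_pos hℓ0]
    rw [e, hn] at h2
    have h3 : ‖ℓ • g s‖ ≤ ‖(φ s₂ - φ s₁) + ℓ • g s‖ + ‖φ s₂ - φ s₁‖ := by
      have := norm_sub_le (φ s₂ - φ s₁ + ℓ • g s) (φ s₂ - φ s₁)
      rwa [add_sub_cancel_left] at this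
    rw [norm_smul, Real.norm_eq_abs, abs_of_pos hℓ0] at h3
    linarith
  -- the algebra
  have hAm : A * ℓ * m ≤ 1 / 4 * m := mul_le_mul_of_nonneg_right hAℓ hm0
  have h1' : 3 / 4 * m ≤ ‖g s‖ + B * ℓ := by nlinarith
  have h1'' : 3 / 4 * m * ℓ ≤ (‖g s‖ + B * ℓ) * ℓ := mul_le_mul_of_nonneg_right h1' hℓ0.le
  have hAm' : A * ℓ * m * ℓ ≤ 1 / 4 * m * ℓ := mul_le_mul_of_nonneg_right hAm hℓ0.le
  have hfin : ‖g s‖ * ℓ ≤ 3 / 2 * D + 2 * B * ℓ * ℓ := by nlinarith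
  calc ‖g s‖ = ‖g s‖ * ℓ / ℓ := by field_simp
    _ ≤ (3 / 2 * D + 2 * B * ℓ * ℓ) / ℓ := by gcongr
    _ = 3 / 2 * D / ℓ + 2 * B * ℓ := by field_simp

/-! ### Step 2: the smooth equation of state on a packing band -/

/-- **EOS band.** From `hsEosLowDensity_proof`: a smooth compressibility factor `Zf` on `(-η₀, η₀)`
agreeing with `hsCompressibility` on `(0, η₀)`, a band `η₁ ≤ min 1 (η₀/2)` and a constant `K ≥ 1`
bounding `|Zf|, |Zf'|, |Zf''|` on `[0, η₁]`, where moreover `Zf ≥ 1/2` and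
`κ = Zf + η Zf' ≥ 1/2`. [folklore] -/
theorem eos_band : ∃ η₀ η₁ K : ℝ, ∃ Zf : ℝ → ℝ, 0 < η₁ ∧ η₁ ≤ 1 ∧ 2 * η₁ ≤ η₀ ∧ 1 ≤ K ∧
    ContDiffOn ℝ ∞ Zf (Ioo (-η₀) η₀) ∧ EqOn hsCompressibility Zf (Ioo 0 η₀) ∧
    ∀ η ∈ Icc 0 η₁, |Zf η| ≤ K ∧ |deriv Zf η| ≤ K ∧ |deriv (deriv Zf) η| ≤ K ∧
      1 / 2 ≤ Zf η ∧ 1 / 2 ≤ Zf η + η * deriv Zf η := by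
  obtain ⟨η₀, hη₀, Zf, hZ, hEq, hZ0⟩ :=
    PolynomialCompressionSmoothPressure.exists_smooth_compressibility hsEosLowDensity_proof
  have hO : IsOpen (Ioo (-η₀) η₀) := isOpen_Ioo
  have hZ1 : ContDiffOn ℝ ∞ (deriv Zf) (Ioo (-η₀) η₀) := hZ.deriv_of_isOpen hO le_rfl
  have hZ2 : ContDiffOn ℝ ∞ (deriv (deriv Zf)) (Ioo (-η₀) η₀) := hZ1.deriv_of_isOpen hO le_rfl
  have hsub : Icc 0 (η₀ / 2) ⊆ Ioo (-η₀) η₀ := fun η hη => ⟨by linarith [hη.1], by linarith [hη.2]⟩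
  have hcpt : IsCompact (Icc (0 : ℝ) (η₀ / 2)) := isCompact_Icc
  obtain ⟨C0, hC0⟩ := hcpt.exists_bound_of_continuousOn (hZ.continuousOn.mono hsub)
  obtain ⟨C1, hC1⟩ := hcpt.exists_bound_of_continuousOn (hZ1.continuousOn.mono hsub)
  obtain ⟨C2, hC2⟩ := hcpt.exists_bound_of_continuousOn (hZ2.continuousOn.mono hsub)
  have h0mem : (0 : ℝ) ∈ Ioo (-η₀) η₀ := ⟨by linarith, hη₀⟩
  have hcZ : ContinuousAt Zf 0 := hZ.continuousOn.continuousAt (hO.mem_nhds h0mem)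
  have hcκ : ContinuousAt (fun η => Zf η + η * deriv Zf η) 0 :=
    hcZ.add (continuousAt_id.mul (hZ1.continuousOn.continuousAt (hO.mem_nhds h0mem)))
  obtain ⟨δ₁, hδ₁, hZδ⟩ := Metric.continuousAt_iff.1 hcZ (1 / 2) (by norm_num)
  obtain ⟨δ₂, hδ₂, hκδ⟩ := Metric.continuousAt_iff.1 hcκ (1 / 2) (by norm_num)
  set K := max 1 (max C0 (max C1 C2)) with hKdef
  set η₁ := min (η₀ / 2) (min 1 (min (δ₁ / 2) (δ₂ / 2))) with hη₁def
  have hK0 : C0 ≤ K := le_max_of_le_right (le_max_left _ _)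
  have hK1 : C1 ≤ K := le_max_of_le_right (le_max_of_le_right (le_max_left _ _))
  have hK2 : C2 ≤ K := le_max_of_le_right (le_max_of_le_right (le_max_right _ _))
  have hη₁a : η₁ ≤ η₀ / 2 := min_le_left _ _
  have hη₁b : η₁ ≤ 1 := (min_le_right _ _).trans (min_le_left _ _)
  have hη₁c : η₁ ≤ δ₁ / 2 := (min_le_right _ _).trans ((min_le_right _ _).trans (min_le_left _ _))
  have hη₁d : η₁ ≤ δ₂ / 2 := (min_le_right _ _).trans ((min_le_right _ _).trans (min_le_right _ _))
  refine ⟨η₀, η₁, K, Zf, by positivity, hη₁b, by linarith, le_max_left _ _, hZ, hEq,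
    fun η hη => ?_⟩
  have hη' : η ∈ Icc 0 (η₀ / 2) := ⟨hη.1, hη.2.trans hη₁a⟩
  have hd1 : dist η 0 < δ₁ := by
    rw [dist_zero_right, Real.norm_eq_abs, abs_of_nonneg hη.1]; linarith [hη.2]
  have hd2 : dist η 0 < δ₂ := by
    rw [dist_zero_right, Real.norm_eq_abs, abs_of_nonneg hη.1]; linarith [hη.2]
  have e1 := hZδ hd1
  have e2 := hκδ hd2
  rw [Real.dist_eq, hZ0] at e1
  rw [Real.dist_eq, hZ0, zero_mul, add_zero] at e2
  have b0 := hC0 η hη'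
  have b1 := hC1 η hη'
  have b2 := hC2 η hη'
  rw [Real.norm_eq_abs] at b0 b1 b2
  refine ⟨b0.trans hK0, b1.trans hK1, b2.trans hK2, ?_, ?_⟩
  · linarith [(abs_lt.1 e1).1]
  · linarith [(abs_lt.1 e2).1]

/-! ### Step 3: elementary real inequalities -/

/-- Inverting `G = θ κ Q + Z Θ` for `Q` under `θ ≥ N⁻¹`, `κ ≥ 1/2`: `|Q| ≤ 2N (|G| + N²)`. [folklore] -/
theorem abs_slope_le {N θ κ Q Z Θ : ℝ} (hN : 1 ≤ N) (hθ : N⁻¹ ≤ θ) (hκ : 1 / 2 ≤ κ)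
    (hZ : |Z| ≤ N) (hΘ : |Θ| ≤ N) :
    |Q| ≤ 2 * N * (|θ * κ * Q + Z * Θ| + N ^ 2) := by
  have hN0 : 0 < N := by linarith
  have hNθ : 1 ≤ N * θ := by
    have h := mul_le_mul_of_nonneg_left hθ hN0.le
    rwa [mul_inv_cancel₀ hN0.ne'] at h
  have h2κ : 1 ≤ 2 * κ := by linarith
  have hθ0 : 0 < θ := lt_of_lt_of_le (inv_pos.2 hN0) hθ
  have hκ0 : 0 < κ := by linarith
  have hZΘ : |Z * Θ| ≤ N * N := abs_mul_le_of_le hZ hΘ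
  have h1 : θ * κ * |Q| ≤ |θ * κ * Q + Z * Θ| + N ^ 2 := by
    have e : θ * κ * |Q| = |θ * κ * Q| := by
      rw [abs_mul, abs_mul, abs_of_pos hθ0, abs_of_pos hκ0]
    rw [e]
    have h := abs_sub (θ * κ * Q + Z * Θ) (Z * Θ)
    rw [add_sub_cancel_right] at h
    nlinarith
  calc |Q| ≤ N * θ * |Q| := le_mul_of_one_le_left (abs_nonneg Q) hNθ
    _ ≤ N * θ * |Q| * (2 * κ) := le_mul_of_one_le_right (by positivity) h2κ
    _ = 2 * N * (θ * κ * |Q|) := by ring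
    _ ≤ 2 * N * (|θ * κ * Q + Z * Θ| + N ^ 2) := by gcongr

/-- The polynomial bookkeeping behind `|D_t Gⱼ| ≤ 38 N⁵ ‖G‖ + 62 N⁷`. [folklore] -/
theorem abs_DtG_le {N g θ κ κ' Q dθ dη dQ Z Z' Θ dΘ S : ℝ} (hN : 1 ≤ N) (hg : 0 ≤ g)
    (hθ : |θ| ≤ N) (hκ : |κ| ≤ 2 * N) (hκ' : |κ'| ≤ 3 * N) (hZ : |Z| ≤ N) (hZ' : |Z'| ≤ N)
    (hΘ : |Θ| ≤ N) (hdθ : |dθ| ≤ 2 * N ^ 3) (hdη : |dη| ≤ 3 * N) (hdΘ : |dΘ| ≤ 15 * N ^ 4)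
    (hQ : |Q| ≤ 2 * N * (g + N ^ 2)) (hdQ : |dQ| ≤ 3 * N + N * S)
    (hS : S ≤ 3 * (2 * N * (g + N ^ 2))) :
    |(dθ * κ + θ * (κ' * dη)) * Q + θ * κ * dQ + (Z' * dη * Θ + Z * dΘ)| ≤
      38 * N ^ 5 * g + 62 * N ^ 7 := by
  set q := 2 * N * (g + N ^ 2) with hq
  have hN0 : 0 ≤ N := by linarith
  have hq0 : 0 ≤ q := by positivity
  have hdQ' : |dQ| ≤ 3 * N + 3 * N * q := hdQ.trans (by nlinarith)
  have t1 : |dθ * κ * Q| ≤ 2 * N ^ 3 * (2 * N) * q := abs_mul_le_of_le (abs_mul_le_of_le hdθ hκ) hQ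
  have t2 : |θ * (κ' * dη) * Q| ≤ N * (3 * N * (3 * N)) * q := abs_mul_le_of_le (abs_mul_le_of_le hθ (abs_mul_le_of_le hκ' hdη)) hQ
  have t3 : |θ * κ * dQ| ≤ N * (2 * N) * (3 * N + 3 * N * q) := abs_mul_le_of_le (abs_mul_le_of_le hθ hκ) hdQ'
  have t4 : |Z' * dη * Θ| ≤ N * (3 * N) * N := abs_mul_le_of_le (abs_mul_le_of_le hZ' hdη) hΘ
  have t5 : |Z * dΘ| ≤ N * (15 * N ^ 4) := abs_mul_le_of_le hZ hdΘ
  have hsum : |(dθ * κ + θ * (κ' * dη)) * Q + θ * κ * dQ + (Z' * dη * Θ + Z * dΘ)| ≤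
      2 * N ^ 3 * (2 * N) * q + N * (3 * N * (3 * N)) * q + N * (2 * N) * (3 * N + 3 * N * q) +
        (N * (3 * N) * N + N * (15 * N ^ 4)) := by
    rw [add_mul]
    refine (abs_add_le _ _).trans (add_le_add ((abs_add_le _ _).trans (add_le_add
      ((abs_add_le _ _).trans (add_le_add t1 t2)) t3)) ((abs_add_le _ _).trans (add_le_add t4 t5)))
  have p34 : N ^ 3 ≤ N ^ 4 := pow_le_pow_right₀ hN (by norm_num)
  have p45 : N ^ 4 ≤ N ^ 5 := pow_le_pow_right₀ hN (by norm_num)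
  have p57 : N ^ 5 ≤ N ^ 7 := pow_le_pow_right₀ hN (by norm_num)
  have p67 : N ^ 6 ≤ N ^ 7 := pow_le_pow_right₀ hN (by norm_num)
  have p37 : N ^ 3 ≤ N ^ 7 := pow_le_pow_right₀ hN (by norm_num)
  have pg : N ^ 4 * g ≤ N ^ 5 * g := mul_le_mul_of_nonneg_right p45 hg
  nlinarith


/-! ### Step 4: the scalar guard bounds at a guarded point -/

/-- The scalar guard bounds used below, at any level `N ≥ M` (velocity components via
`Torus.partialDeriv_apply_coord`). [folklore] -/
theorem guard_bounds {η M N σ : ℝ} {ρ θ : ℝ → T3 → ℝ} {u : ℝ → T3 → V3} {s : ℝ} {x : T3}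
    (hG : GuardAt η M σ ρ θ u s x) (hMN : M ≤ N)
    (hus : Torus.IsSmooth (u s)) :
    ρ s x * σ ^ 3 < η ∧ θ s x ≤ N ∧ M⁻¹ ≤ θ s x ∧ (∀ i, |u s x i| ≤ N) ∧
    (∀ i, |Torus.partialDeriv i (ρ s) x| ≤ N) ∧ (∀ i, |Torus.partialDeriv i (θ s) x| ≤ N) ∧
    (∀ i j, |Torus.partialDeriv i (Torus.partialDeriv j (θ s)) x| ≤ N) ∧
    (∀ i j, |Torus.partialDeriv i (fun y => u s y j) x| ≤ N) ∧
    (∀ i j k, |Torus.partialDeriv i (Torus.partialDeriv j (fun y => u s y k)) x| ≤ N) := by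
  obtain ⟨h1, -, h3, h4, h5, h6⟩ := hG
  have hu1 : Torus.IsContDiff 1 (u s) := hus.isContDiff (by simp)
  refine ⟨h1, h3.trans hMN, h4, fun i => ?_, fun i => (h6 i 0 0).1.trans hMN,
    fun i => (h6 i 0 0).2.2.1.trans hMN, fun i j => (h6 i j 0).2.2.2.2.2.1.trans hMN,
    fun i j => ?_, fun i j k => ?_⟩
  · have h := PiLp.norm_apply_le (u s x) i
    rw [Real.norm_eq_abs] at h
    exact h.trans (h5.trans hMN)
  · rw [Torus.partialDeriv_apply_coord hu1 i x j]
    have h := PiLp.norm_apply_le (Torus.partialDeriv i (u s) x) j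
    rw [Real.norm_eq_abs] at h
    exact h.trans ((h6 i 0 0).2.1.trans hMN)
  · have hfun : (Torus.partialDeriv j fun y => u s y k) = fun y => Torus.partialDeriv j (u s) y k :=
      funext fun y => Torus.partialDeriv_apply_coord hu1 j y k
    have hDu1 : Torus.IsContDiff 1 (Torus.partialDeriv j (u s)) :=
      (hus.partialDeriv j).isContDiff (by simp)
    rw [hfun, Torus.partialDeriv_apply_coord hDu1 i x k]
    have h := PiLp.norm_apply_le (Torus.partialDeriv i (Torus.partialDeriv j (u s)) x) k
    rw [Real.norm_eq_abs] at h
    exact h.trans ((h6 i j 0).2.2.2.2.1.trans hMN)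

end Summit.AtomisticToContinuum.HydrodynamicLimit.Theorems.ConeLocalisation.Elevator.LogSlope

namespace Summit.AtomisticToContinuum.HydrodynamicLimit.Theorems.ConeLocalisation.Elevator

open Literature.MathematicalPhysics.KineticTheory

/-- **Registered sub-goal `stub_logSlope_partA` of the stub `stub_logSlope`** (part A of its proof, registered on
stmt-AtomisticToContinuum-12504 for the supports lane): the smooth equation of state on a packing band. [folklore] -/
theorem stub_logSlope_partA : ∃ η₀ η₁ K : ℝ, ∃ Zf : ℝ → ℝ, 0 < η₁ ∧ η₁ ≤ 1 ∧ 2 * η₁ ≤ η₀ ∧ 1 ≤ K ∧ ContDiffOn ℝ (⊤ : ℕ∞) Zf (Set.Ioo (-η₀) η₀) ∧ Set.EqOn hsCompressibility Zf (Set.Ioo 0 η₀) ∧ ∀ η ∈ Set.Icc 0 η₁, |Zf η| ≤ K ∧ |deriv Zf η| ≤ K ∧ |deriv (deriv Zf) η| ≤ K ∧ 1 / 2 ≤ Zf η ∧ 1 / 2 ≤ Zf η + η * deriv Zf η :=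
  LogSlope.eos_band

end Summit.AtomisticToContinuum.HydrodynamicLimit.Theorems.ConeLocalisation.Elevator

end
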